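import Mathlib
import HarnessLib
import Literature.Probability.Percolation.BlockResampling

/-!
# Crux `PercTreeValue.TetrahedronHarrisGap` (stmt-CriticalPhenomena-7799), line `SketchIdeator1`
# (closed-collar total covariance, rev 7) — stub `stub_determinedBy_blockCondProb`

Helper file for the crux skeleton `Cruxes/TetrahedronHarrisGap/Lines/SketchIdeator1.lean`
(lead prover-line-stmt-CriticalPhenomena-7799-c3-0, skeleton rev 7),
`--supports stmt-CriticalPhenomena-7799`.  No new definitions; everything is stated in the tree's
vocabulary (`blockCondProb`, `DeterminedBy`).

The written-out conditional probability given the configuration off a finite block `K` of pairs,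
`blockCondProb G p K E ω = Σ_{ξ ⊆ K} P_p(obs K = ξ) · 𝟙_E(ω ∖ K ∪ ξ)` (`BlockResampling.lean`),
mentions `ω` only through `ω ∖ K`.  Hence (1) two configurations with the same trace off `K` have
the same block-conditional probability (`blockCondProb_congr_sdiff`), and (2) every super-level
set `{ω | κ ≤ blockCondProb G p K E ω}` is determined by the pairs off `K` in the sense of
`DeterminedBy` (`determinedBy_iff`, `ω ∩ Kᶜ = ω ∖ K`).
-/

noncomputable section

open MeasureTheory Literature.Probability.Percolation Literature.Probability.LatticeModels

namespace Summit.CriticalPhenomena.PercolationContinuityZ3.Theorems.TetrahedronHarrisGap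

/-- **`P_p(E | ω off K)` is a function of `ω ∖ K`.**  If `ω ∖ K = ω' ∖ K` then
`blockCondProb G p K E ω = blockCondProb G p K E ω'`: the defining sum
`Σ_{ξ ⊆ K} P_p(obs K = ξ) · 𝟙_E(ω ∖ K ∪ ξ)` only involves `ω ∖ K`. -/
theorem blockCondProb_congr_sdiff {V : Type*} (G : SimpleGraph V) (p : unitInterval)
    (K : Finset (Sym2 V)) (E : Set (BondConfig V)) {ω ω' : BondConfig V}
    (h : ω \ (↑K : Set (Sym2 V)) = ω' \ ↑K) :
    blockCondProb G p K E ω = blockCondProb G p K E ω' := by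
  unfold blockCondProb
  rw [h]

/-- **stub_determinedBy_blockCondProb** (registered stub of line `SketchIdeator1`, rev 7):
(1) the block-conditional probability `blockCondProb G p K E ω` depends on `ω` only through
`ω ∖ K` (`blockCondProb_congr_sdiff`); (2) consequently each super-level set
`{ω | κ ≤ blockCondProb G p K E ω}` is determined by the pairs off `K`: configurations agreeing on
`(↑K)ᶜ` have equal traces `ω ∩ Kᶜ = ω ∖ K` (`Set.sdiff_eq`), hence equal block-conditional
probabilities (`determinedBy_iff`). -/
theorem stub_determinedBy_blockCondProb :
    ∀ {V : Type*} [Countable V] (G : SimpleGraph V) (p : unitInterval) (K : Finset (Sym2 V)) (E : Set (BondConfig V)),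
      (∀ ω ω' : BondConfig V, ω \ (↑K : Set (Sym2 V)) = ω' \ ↑K → blockCondProb G p K E ω = blockCondProb G p K E ω') ∧
      ∀ κ : ℝ, DeterminedBy {ω : BondConfig V | κ ≤ blockCondProb G p K E ω} (↑K : Set (Sym2 V))ᶜ := by
  intro V _ G p K E
  refine ⟨fun ω ω' h => blockCondProb_congr_sdiff G p K E h, fun κ => ?_⟩
  rw [determinedBy_iff]
  intro ω ω' h
  rw [← Set.sdiff_eq, ← Set.sdiff_eq] at h
  simp only [Set.mem_setOf_eq]
  rw [blockCondProb_congr_sdiff G p K E h]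

end Summit.CriticalPhenomena.PercolationContinuityZ3.Theorems.TetrahedronHarrisGap

end
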